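import Literature.NumberTheory.ComplexMultiplication.SexticCMTypesB3Abstract
import HarnessLib

/-!
# Sextic CM fields WITHOUT sign changes: an index-two subgroup above the stabiliser
# (the Galois-group half of «a sextic CM field has pair flips or contains an imaginary quadratic field»)

Companion of `SexticCMTypesB3.lean` / `SexticCMTypesB3Abstract.lean` (there: `|G| ∈ {24, 48}` ⟹ all three sign changes
`f0 f1 f2` lie in `G` and NO index-two subgroup contains a point stabiliser).  Here the converse half of Dodson's list
for `n = 3` [Dodson1984, §5.1.2 Theorem: the `ρ`-structures `ℤ₂ × G₀` versus `(ℤ₂)³ ⋊ G₀`, `G₀ ∈ {ℤ₃, 𝔖₃}`]: if a group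
`G` acting transitively on six points `X`, commuting with a fixed-point-free involution `c` (complex conjugation), contains
NO sign change at `x₀` (no `g` acting as `c` on `{x₀, c x₀}` and trivially elsewhere), then there is a subgroup
`H ≤ G` of INDEX TWO containing the stabiliser of `x₀` and not containing `c` — by the Galois correspondence: the
sextic CM field contains an imaginary quadratic field (`CorCM`-side consumer: the census of pairs of simple CM
threefolds).

* Computations in `W(B₃) = C_{𝔖₆}(cc)` (`decide`, kernel): `exists_word'_eq` (the `48` words `f0^a f1^b f2^c rot^k s12^e`
  exhaust `W`); the PARITY `(Bool.xor (Bool.xor (decide (3 ≤ (g 0).val)) (decide (3 ≤ (g 1).val))) (decide (3 ≤ (g 2).val)))` = number of the places `0, 1, 2` sent by `g` to the conjugate half `{3, 4, 5}`,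
  mod `2` — `par_mul` (a homomorphism `W → ℤ/2`; it is the sum of the three sign coordinates of
  `W = (ℤ/2)³ ⋊ 𝔖₃`), `par_cc` (`= 1`), and **`flip_cases`**: an element of `W` FIXING `0` with odd parity is `f1`, `f2`,
  or squares to `cc·f0` — so it produces a sign change;
* **`exists_index_two_of_no_flip`** (abstract, any group `G` acting on a six-element `X` commuting with `c`,
  transitive, no sign change at `x₀`): `H = {g | (Bool.xor (Bool.xor (decide (3 ≤ (g 0).val)) (decide (3 ≤ (g 1).val))) (decide (3 ≤ (g 2).val))) = 0}` has index `2`, contains `Stab_G(x₀)`, misses `c`.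
  Faithfulness is not needed (`G = Aut(ℂ)` acting on `Hom(K, ℂ)` is allowed).

Pure finite group theory; no field theory here.  Theorems only (the parity is written out as a `Bool` expression, no definition), no `sorry`.

## References

* B. Dodson, *The structure of Galois groups of CM-fields*, Trans. AMS 283 (1984) 1–32 [Dodson1984], §1.1
  Imprimitivity Theorem, §5.1.2 Theorem (`n = 3`: `ℤ₂ × ℤ₃`, `ℤ₂ × 𝔖₃`, `(ℤ₂)³ ⋊ ℤ₃`, `(ℤ₂)³ ⋊ 𝔖₃`).
-/

set_option autoImplicit false

namespace Literature.NumberTheory.ComplexMultiplication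

namespace SexticB3

open Equiv

/-! ### Computations in `W(B₃)` -/

section Computations

/-- The `48` words commute with `cc`. [folklore] -/
private theorem word'_mul_cc : ∀ v : (Fin 2 × Fin 2 × Fin 2 × Fin 3) × Fin 2, word' v * cc = cc * word' v := by
  decide +kernel

set_option maxRecDepth 20000 in
/-- `|C_{𝔖₆}(cc)| = 48` (as a filter of `𝔖₆`). [cite: Dodson1984, §1.1 Imprimitivity Theorem] -/
theorem card_filter_mul_cc :
    (Finset.univ.filter fun g : Perm (Fin 6) => g * cc = cc * g).card = 48 := by
  decide

/-- **The `48` words `f0^a f1^b f2^c rot^k s12^e` exhaust `W(B₃)`**: every permutation commuting with `cc` is one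
of them. [cite: Dodson1984, §1.1 Imprimitivity Theorem] -/
theorem exists_word'_eq {g : Perm (Fin 6)} (hg : g * cc = cc * g) :
    ∃ v : (Fin 2 × Fin 2 × Fin 2 × Fin 3) × Fin 2, word' v = g := by
  classical
  have hsub : (Finset.univ.image word') ⊆ (Finset.univ.filter fun g : Perm (Fin 6) => g * cc = cc * g) := by
    intro p hp
    simp only [Finset.mem_image, Finset.mem_univ, true_and] at hp
    obtain ⟨v, rfl⟩ := hp
    exact Finset.mem_filter.2 ⟨Finset.mem_univ _, word'_mul_cc v⟩
  have heq := Finset.eq_of_subset_of_card_le hsub (by rw [card_filter_mul_cc, card_words'])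
  have hmem : g ∈ Finset.univ.image word' := by
    rw [heq]
    exact Finset.mem_filter.2 ⟨Finset.mem_univ _, hg⟩
  simpa only [Finset.mem_image, Finset.mem_univ, true_and] using hmem

/-- The identity has even parity (the PARITY of `g ∈ 𝔖₆` is the number of the places `0, 1, 2` sent into the
conjugate half `{3, 4, 5}`, mod `2`, written out as a `Bool`). [folklore] -/
private theorem par_one :
    Bool.xor (Bool.xor (decide (3 ≤ ((1 : Perm (Fin 6)) 0).val)) (decide (3 ≤ ((1 : Perm (Fin 6)) 1).val)))
      (decide (3 ≤ ((1 : Perm (Fin 6)) 2).val)) = false := by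
  decide

/-- Complex conjugation has odd parity (it changes all three signs). [folklore] -/
private theorem par_cc :
    Bool.xor (Bool.xor (decide (3 ≤ (cc 0).val)) (decide (3 ≤ (cc 1).val))) (decide (3 ≤ (cc 2).val)) = true := by
  decide

set_option maxRecDepth 20000 in
/-- The parity is additive on the `48 × 48` products of words. [folklore] -/
private theorem par_word'_mul_word' : ∀ v w : (Fin 2 × Fin 2 × Fin 2 × Fin 3) × Fin 2,
    Bool.xor (Bool.xor (decide (3 ≤ ((word' v * word' w) 0).val)) (decide (3 ≤ ((word' v * word' w) 1).val)))
        (decide (3 ≤ ((word' v * word' w) 2).val)) =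
      Bool.xor
        (Bool.xor (Bool.xor (decide (3 ≤ (word' v 0).val)) (decide (3 ≤ (word' v 1).val)))
          (decide (3 ≤ (word' v 2).val)))
        (Bool.xor (Bool.xor (decide (3 ≤ (word' w 0).val)) (decide (3 ≤ (word' w 1).val)))
          (decide (3 ≤ (word' w 2).val))) := by
  decide +kernel

/-- **The parity is a homomorphism `W(B₃) → ℤ/2`.** [cite: Dodson1984, §1.1 Imprimitivity Theorem] -/
theorem par_mul {g h : Perm (Fin 6)} (hg : g * cc = cc * g) (hh : h * cc = cc * h) :
    Bool.xor (Bool.xor (decide (3 ≤ ((g * h) 0).val)) (decide (3 ≤ ((g * h) 1).val))) (decide (3 ≤ ((g * h) 2).val)) =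
      Bool.xor (Bool.xor (Bool.xor (decide (3 ≤ (g 0).val)) (decide (3 ≤ (g 1).val))) (decide (3 ≤ (g 2).val)))
        (Bool.xor (Bool.xor (decide (3 ≤ (h 0).val)) (decide (3 ≤ (h 1).val))) (decide (3 ≤ (h 2).val))) := by
  obtain ⟨v, rfl⟩ := exists_word'_eq hg
  obtain ⟨w, rfl⟩ := exists_word'_eq hh
  exact par_word'_mul_word' v w

set_option maxRecDepth 20000 in
/-- The words fixing `0` with odd parity. [folklore] -/
private theorem word'_apply_zero_cases : ∀ v : (Fin 2 × Fin 2 × Fin 2 × Fin 3) × Fin 2, word' v 0 = 0 →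
    Bool.xor (Bool.xor (decide (3 ≤ (word' v 0).val)) (decide (3 ≤ (word' v 1).val))) (decide (3 ≤ (word' v 2).val)) =
      true → (word' v = f1 ∨ word' v = f2 ∨ cc * (word' v * word' v) = f0) := by
  decide +kernel

/-- **An element of `W(B₃)` fixing the place `0` with ODD parity produces a sign change**: it is the sign change `f1`
or `f2`, or its square times `cc` is the sign change `f0` (it exchanges the places `1`, `2` with one twist, so its
square is `f1 f2 = cc f0`). [cite: Dodson1984, §5.1.2 Theorem] -/
theorem flip_cases {g : Perm (Fin 6)} (hg : g * cc = cc * g) (h0 : g 0 = 0)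
    (hpar : Bool.xor (Bool.xor (decide (3 ≤ (g 0).val)) (decide (3 ≤ (g 1).val))) (decide (3 ≤ (g 2).val)) = true) :
    g = f1 ∨ g = f2 ∨ cc * (g * g) = f0 := by
  obtain ⟨v, rfl⟩ := exists_word'_eq hg
  exact word'_apply_zero_cases v h0 hpar

/-- `f0` is the sign change at the place `0`. [folklore] -/
private theorem f0_isFlip : f0 0 = cc 0 ∧ ∀ i : Fin 6, i ≠ 0 → i ≠ cc 0 → f0 i = i := by decide

/-- `f1` is the sign change at the place `1`. [folklore] -/
private theorem f1_isFlip : f1 1 = cc 1 ∧ ∀ i : Fin 6, i ≠ 1 → i ≠ cc 1 → f1 i = i := by decide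

/-- `f2` is the sign change at the place `2`. [folklore] -/
private theorem f2_isFlip : f2 2 = cc 2 ∧ ∀ i : Fin 6, i ≠ 2 → i ≠ cc 2 → f2 i = i := by decide

end Computations

/-! ### The abstract statement -/

section Abstract

variable {G : Type*} [Group G] {X : Type*} [Fintype X] [DecidableEq X] [MulAction G X]

/-- **No sign change ⟹ an index-two subgroup above the stabiliser.**  Let a group `G` act on a six-element type `X`
commuting with `c ∈ G`, where `c` acts as a fixed-point-free involution, TRANSITIVELY, and assume `G` contains no
sign change at `x₀` (no element acting as `c` on `x₀` and trivially off `{x₀, c x₀}`).  Then some subgroup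
`H ≤ G` has index `2`, contains `Stab_G(x₀)` and does not contain `c`.  (For `G = Gal(L/ℚ)` or `Aut(ℂ)` on the
embeddings of a sextic CM field `K`: `K` contains an imaginary quadratic field.  No faithfulness assumed.)
[cite: Dodson1984, §5.1.2 Theorem] -/
theorem exists_index_two_of_no_flip (hX : Fintype.card X = 6) (c : G)
    (hcomm : ∀ (g : G) (x : X), c • g • x = g • c • x) (hc2 : ∀ x : X, c • c • x = x)
    (hfix : ∀ x : X, c • x ≠ x) (htrans : ∀ x y : X, ∃ g : G, g • x = y) (x₀ : X)
    (hno : ∀ g : G, g • x₀ = c • x₀ → ∃ y : X, y ≠ x₀ ∧ y ≠ c • x₀ ∧ g • y ≠ y) :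
    ∃ H : Subgroup G, H.index = 2 ∧ MulAction.stabilizer G x₀ ≤ H ∧ c ∉ H := by
  classical
  -- normal form for the involution `c`
  obtain ⟨e, he0, hce⟩ := exists_equiv_cc hX (MulAction.toPerm c)
    (fun x => by simpa [MulAction.toPerm_apply] using hc2 x) (fun x => by simpa [MulAction.toPerm_apply] using hfix x)
    x₀
  replace hce : ∀ x, e (c • x) = cc (e x) := fun x => by simpa [MulAction.toPerm_apply] using hce x
  have hce' : ∀ i, e.symm (cc i) = c • e.symm i := fun i =>
    e.injective (by rw [Equiv.apply_symm_apply, hce, Equiv.apply_symm_apply])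
  have hx0 : e.symm 0 = x₀ := by rw [← he0, Equiv.symm_apply_apply]
  -- the permutation image `f : G → W(B₃)`
  set f : G →* Perm (Fin 6) := toPerm6 e with hf
  have hfapp : ∀ (g : G) (i : Fin 6), f g i = e (g • e.symm i) := fun g i => toPerm6_apply e g i
  have hfe : ∀ (g : G) (x : X), e (g • x) = f g (e x) := fun g x => by rw [hfapp, Equiv.symm_apply_apply]
  have hfW : ∀ g : G, f g * cc = cc * f g := fun g => by
    ext i
    rw [Perm.mul_apply, Perm.mul_apply, hfapp, hce', hfapp, ← hce, hcomm]
  have hfc : f c = cc := toPerm6_eq_cc hce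
  -- a sign change in `f(G)` at any place conjugates to a sign change at `x₀`: excluded
  have hflip : ∀ (g : G) (a : Fin 6), f g a = cc a → (∀ i, i ≠ a → i ≠ cc a → f g i = i) → False := by
    intro g a ha hi
    obtain ⟨g₂, hg₂⟩ := htrans (e.symm a) x₀
    have hga : g • e.symm a = c • e.symm a :=
      e.injective (by rw [hfe, Equiv.apply_symm_apply, ha, hce, Equiv.apply_symm_apply])
    obtain ⟨y, hy0, hyc, hy⟩ := hno (g₂ * g * g₂⁻¹) (by
      rw [mul_smul, mul_smul, ← hg₂, inv_smul_smul, hga, ← hcomm])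
    apply hy
    have hw1 : e (g₂⁻¹ • y) ≠ a := fun h => hy0 (by
      have : g₂⁻¹ • y = e.symm a := by rw [← h, Equiv.symm_apply_apply]
      rw [← hg₂, ← this, smul_inv_smul])
    have hw2 : e (g₂⁻¹ • y) ≠ cc a := fun h => hyc (by
      have : g₂⁻¹ • y = c • e.symm a := by rw [← hce', ← h, Equiv.symm_apply_apply]
      calc y = g₂ • g₂⁻¹ • y := (smul_inv_smul g₂ y).symm
        _ = g₂ • c • e.symm a := by rw [this]
        _ = c • g₂ • e.symm a := (hcomm g₂ _).symm
        _ = c • x₀ := by rw [hg₂])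
    have hgw : g • g₂⁻¹ • y = g₂⁻¹ • y := e.injective (by rw [hfe, hi _ hw1 hw2])
    rw [mul_smul, mul_smul, hgw, smul_inv_smul]
  -- the parity of `f g`, `g ∈ G` (a homomorphism `G → ℤ/2` by `par_mul`)
  let P : Perm (Fin 6) → Bool := fun p =>
    Bool.xor (Bool.xor (decide (3 ≤ (p 0).val)) (decide (3 ≤ (p 1).val))) (decide (3 ≤ (p 2).val))
  have hP1 : P 1 = false := par_one
  have hPc : P cc = true := par_cc
  have hPmul : ∀ a b : G, P (f (a * b)) = Bool.xor (P (f a)) (P (f b)) := fun a b => by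
    show Bool.xor (Bool.xor (decide (3 ≤ (f (a * b) 0).val)) (decide (3 ≤ (f (a * b) 1).val)))
        (decide (3 ≤ (f (a * b) 2).val)) = _
    rw [map_mul, par_mul (hfW a) (hfW b)]
  -- the subgroup of even parity
  let H : Subgroup G :=
    { carrier := {g | P (f g) = false}
      one_mem' := by
        show P (f 1) = false
        rw [map_one]
        exact hP1
      mul_mem' := fun {a b} ha hb => by
        have ha' : P (f a) = false := ha
        have hb' : P (f b) = false := hb
        show P (f (a * b)) = false
        rw [hPmul, ha', hb']
        rfl
      inv_mem' := fun {a} ha => by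
        have ha' : P (f a) = false := ha
        show P (f a⁻¹) = false
        have h := hPmul a⁻¹ a
        rw [inv_mul_cancel, map_one, hP1, ha', Bool.xor_false] at h
        exact h.symm }
  have hmem : ∀ g : G, g ∈ H ↔ P (f g) = false := fun g => Iff.rfl
  refine ⟨H, ?_, ?_, ?_⟩
  · -- index two: `g ↦ g c` exchanges `H` and its complement
    rw [Subgroup.index_eq_two_iff]
    refine ⟨c, fun b => ?_⟩
    rw [hmem, hmem, hPmul, hfc, hPc]
    cases P (f b) <;> decide
  · -- the stabiliser of `x₀` has even parity (else a sign change appears)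
    intro t ht
    rw [MulAction.mem_stabilizer_iff] at ht
    rw [hmem]
    by_contra hpar
    have hpar' : P (f t) = true := by simpa using hpar
    have h0 : f t 0 = 0 := by rw [hfapp, hx0, ht, he0]
    rcases flip_cases (hfW t) h0 hpar' with h1 | h2 | h3
    · exact hflip t 1 (by rw [h1]; exact f1_isFlip.1) (fun i hi hi' => by rw [h1]; exact f1_isFlip.2 i hi hi')
    · exact hflip t 2 (by rw [h2]; exact f2_isFlip.1) (fun i hi hi' => by rw [h2]; exact f2_isFlip.2 i hi hi')
    · have hg : f (c * (t * t)) = f0 := by rw [map_mul, map_mul, hfc, h3]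
      exact hflip (c * (t * t)) 0 (by rw [hg]; exact f0_isFlip.1) (fun i hi hi' => by rw [hg]; exact f0_isFlip.2 i hi hi')
  · -- `c` has odd parity
    rw [hmem, hfc, hPc]
    decide

end Abstract

end SexticB3

end Literature.NumberTheory.ComplexMultiplication
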